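import Summits.HubbardSuperconductivity.HubbardLadder.Bounds.TwistedFluxCoupling
import Summits.HubbardSuperconductivity.HubbardLadder.Bounds.ThermalStiffnessCeilingTPrime
import Summits.HubbardSuperconductivity.HubbardSuperconductivity.Theorems.WidthHaldaneTubeSectorPartitionBlock
import HarnessLib

/-!
# Canonical `N`-particle sectors of the twisted `t–t'` Hubbard torus as Fourier coefficients of
# the grand-canonical Gibbs factor at COMPLEX fugacity (bounds.tex §13, step 0)

HONEST FRAMING (cell pub-hubbard): ladder R1–R4 with certified numbers; no claim on H/H₀. Bounds for
model classes (the `t–t'` Hubbard torus in its canonical sectors of fixed total particle number),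
no materials claim. Imports only landed modules (`TwistedFluxCoupling` #195.4,
`ThermalStiffnessCeilingTPrime` for the tree's shortcut instance
`instDecidableEqFinsetOrbFermionTorus` — so the sector blocks below are the same objects as in
#191's `HighTemperatureNoStiffnessCanonical` — and the tree's block-exponential lemmas of
`WidthHaldaneTubeSectorPartitionBlock`).

This is the first step of the canonical-ensemble no-stiffness theorem (bounds.tex Thm 13) in the
`N`-SECTOR form (fixed total `N = N↑ + N↓`, spin free): the sector partition function is a discrete
Fourier coefficient of the generalised Gibbs factor `Zc(β, U, μ; c)` of the tree
(`HubbardBondAlgebra.Zc`) at the COMPLEX chemical potentials `μ_k = ζ_k/β`,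
`ζ_k = ζ₀ + 2πik/M`, `k = 0, …, M-1`, any `M` exceeding the number of orbitals and any base point
`ζ₀ ∈ ℂ` (the centring freedom used by the sector-weight floor of Lemma 13.3).

THEOREMS (0 sorry).
* `sum_range_cexp_two_pi_mul_I_eq` — orthogonality of the `M`-th roots of unity:
  `Σ_{k<M} e^{2πikm/M} = M·[m = 0]` for integers `|m| < M`.
* `sum_filter_diag_eq_fourier` (generic) — for any square matrix `G` indexed by a finite type with an
  integer charge `q < M` and any `N < M`:
  `Σ_{s : q s = N} G_{ss} = M⁻¹ Σ_{k<M} e^{-Nζ_k} Tr(diag(e^{ζ_k q}) G)`.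
* `partitionFn_toBlock_card_eq_sum_gibbsWeight` — for a particle-number conserving `H`,
  `Z_N := partitionFn β (H|_{#s = N}) = Σ_{#s = N} (e^{-βH})_{ss}` (block exponential).
* `trace_fugacity_mul_gibbsWeight_hubbardTorusTT'Flux_eq_Zc` — the dictionary at complex fugacity:
  `Tr(diag(e^{ζ #s}) e^{-βH^{tt'}_L(θ)}) = Zc(β, U, ζ/β; ttFluxCoupling L β t' θ)` (`L ≥ 3`, `β ≠ 0`).
* **`partitionFn_toBlock_card_hubbardTorusTT'Flux_eq_fourier`** — the sector projection:
  `Z_N(θ) = M⁻¹ Σ_{k<M} e^{-Nζ_k} Zc(β, U, ζ_k/β; ttFluxCoupling L β t' θ)` for `N < M`,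
  `#orbitals < M`.

References: bounds.tex §13 (13.1); folklore (discrete Fourier inversion on `ℤ/Mℤ`); D. Ueltschi,
J. Stat. Phys. 95 (1999) 693 §2.3 [Ueltschi1999] (complex parameters in the polymer expansion).
-/

namespace Summit.HubbardSuperconductivity.HubbardLadder.Bounds

open Matrix Finset Complex
open Literature.MathematicalPhysics.QuantumLattice
open Summit.HubbardSuperconductivity.HubbardSuperconductivity.Theorems.WidthHaldane
open Summit.HubbardSuperconductivity.HubbardSuperconductivity.Theorems (trace_diagonal_mul_eq_sum)

/-! ### Orthogonality of roots of unity -/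

/-- The `k`-th of `M` equally spaced points on the vertical line through `ζ₀`:
`fourierPoint M ζ₀ k = ζ₀ + 2πik/M`. [programme definition: bounds.tex §13 (13.1)] -/
noncomputable def fourierPoint (M : ℕ) (ζ₀ : ℂ) (k : ℕ) : ℂ := ζ₀ + 2 * Real.pi * I * k / M

/-- **Orthogonality of the `M`-th roots of unity**: `Σ_{k<M} e^{2πi(m/M)k} = M` if `m = 0` and `0`
otherwise, for integers `|m| < M`. [folklore] -/
theorem sum_range_cexp_two_pi_mul_I_eq {M : ℕ} {m : ℤ} (hm : |m| < M) :
    ∑ k ∈ Finset.range M, cexp (2 * Real.pi * I * (m / M) * k) = if m = 0 then (M : ℂ) else 0 := by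
  have hM : 0 < M := by
    have := (abs_nonneg m).trans_lt hm
    exact_mod_cast this
  have hMne : (M : ℂ) ≠ 0 := by exact_mod_cast hM.ne'
  split_ifs with h
  · simp [h]
  · set w : ℂ := cexp (2 * Real.pi * I * (m / M)) with hw
    have hk : ∀ k : ℕ, cexp (2 * Real.pi * I * (m / M) * k) = w ^ k := fun k => by
      rw [hw, ← Complex.exp_nat_mul, mul_comm]
    have hw1 : w ≠ 1 := by
      intro h1
      rw [hw, Complex.exp_eq_one_iff] at h1
      obtain ⟨n, hn⟩ := h1
      have hmn : (m : ℂ) = n * M := by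
        have h2 : (2 * Real.pi * I : ℂ) ≠ 0 := by simp [Real.pi_ne_zero, Complex.I_ne_zero]
        field_simp at hn
        linear_combination hn
      have hmn' : m = n * M := by exact_mod_cast hmn
      have hdvd : (M : ℤ) ∣ m := ⟨n, by rw [hmn', mul_comm]⟩
      exact h (Int.eq_zero_of_abs_lt_dvd hdvd hm)
    have hwM : w ^ M = 1 := by
      rw [hw, ← Complex.exp_nat_mul, show (M : ℂ) * (2 * Real.pi * I * (m / M)) = m * (2 * Real.pi * I) by
        field_simp]
      exact Complex.exp_int_mul_two_pi_mul_I m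
    rw [Finset.sum_congr rfl fun k _ => hk k, geom_sum_eq hw1, hwM, sub_self, zero_div]

/-! ### Discrete Fourier inversion for a charge-diagonal weight (generic) -/

section Generic

variable {ι : Type*} [Fintype ι] [DecidableEq ι]

/-- **Discrete Fourier inversion.** For a square matrix `G` over a finite index type with a charge
`q : ι → ℕ`, `q < M` everywhere, and `N < M`: the charge-`N` diagonal sum is the `N`-th Fourier
coefficient of the fugacity-weighted traces at the `M` points `ζ_k = ζ₀ + 2πik/M`,
`Σ_{s : q s = N} G_{ss} = M⁻¹ Σ_{k<M} e^{-Nζ_k} Tr(diag(e^{ζ_k q_s}) G)`. [folklore; bounds.tex (13.1)] -/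
theorem sum_filter_diag_eq_fourier (q : ι → ℕ) (G : Matrix ι ι ℂ) {M N : ℕ} (hq : ∀ s, q s < M)
    (hN : N < M) (ζ₀ : ℂ) :
    ∑ s ∈ Finset.univ.filter (fun s => q s = N), G s s =
      (M : ℂ)⁻¹ * ∑ k ∈ Finset.range M, cexp (-(N * fourierPoint M ζ₀ k)) *
        (diagonal (fun s => cexp (fourierPoint M ζ₀ k * q s)) * G).trace := by
  have hM : 0 < M := lt_of_le_of_lt (Nat.zero_le N) hN
  have hMne : (M : ℂ) ≠ 0 := by exact_mod_cast hM.ne'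
  -- the phase sum of one basis state
  have hkey : ∀ s : ι, ∑ k ∈ Finset.range M, cexp (-(N * fourierPoint M ζ₀ k)) *
      cexp (fourierPoint M ζ₀ k * q s) = if q s = N then (M : ℂ) * cexp (ζ₀ * (q s - N)) else 0 := by
    intro s
    have hm : |((q s : ℤ) - N)| < M := by
      have := hq s
      rw [abs_lt]
      constructor <;> omega
    have hterm : ∀ k : ℕ, cexp (-(N * fourierPoint M ζ₀ k)) * cexp (fourierPoint M ζ₀ k * q s) =
        cexp (ζ₀ * (q s - N)) * cexp (2 * Real.pi * I * ((((q s : ℤ) - N : ℤ) : ℂ) / M) * k) := by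
      intro k
      rw [← Complex.exp_add, ← Complex.exp_add]
      congr 1
      push_cast
      unfold fourierPoint
      field_simp
      ring
    rw [Finset.sum_congr rfl fun k _ => hterm k, ← Finset.mul_sum, sum_range_cexp_two_pi_mul_I_eq hm]
    by_cases hs : q s = N
    · have : ((q s : ℤ) - N : ℤ) = 0 := by omega
      rw [if_pos this, if_pos hs, mul_comm]
    · have : ((q s : ℤ) - N : ℤ) ≠ 0 := by omega
      rw [if_neg this, if_neg hs, mul_zero]
  have hinner : ∑ k ∈ Finset.range M, cexp (-(N * fourierPoint M ζ₀ k)) *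
      (diagonal (fun s => cexp (fourierPoint M ζ₀ k * q s)) * G).trace =
      (M : ℂ) * ∑ s ∈ Finset.univ.filter (fun s => q s = N), G s s := by
    simp_rw [trace_diagonal_mul_eq_sum, Finset.mul_sum, ← mul_assoc]
    rw [Finset.sum_comm]
    simp_rw [← Finset.sum_mul, hkey, ite_mul, zero_mul, Finset.sum_ite, Finset.sum_const_zero, add_zero]
    refine Finset.sum_congr rfl fun s hs => ?_
    rw [(Finset.mem_filter.1 hs).2, sub_self, mul_zero, Complex.exp_zero, mul_one]
  rw [hinner, ← mul_assoc, inv_mul_cancel₀ hMne, one_mul]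

end Generic

/-! ### Particle-number blocks of a number-conserving Hamiltonian -/

section Number

variable {Λ : Type*} [LinearOrder Λ] [Fintype Λ]

omit [LinearOrder Λ] [Fintype Λ] in
/-- A number-conserving matrix has no entries from the block `#s = N` to its complement. [folklore] -/
theorem toBlock_card_compl_eq_zero {H : Matrix (Finset (Orb Λ)) (Finset (Orb Λ)) ℂ}
    (hH : ∀ s s', H s s' ≠ 0 → s.card = s'.card) (N : ℕ) :
    H.toBlock (fun s => s.card = N) (fun s => ¬ s.card = N) = 0 := by
  ext a b
  simp only [toBlock_apply, Matrix.zero_apply]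
  by_contra h
  exact b.2 ((hH _ _ h).symm.trans a.2)

/-- A matrix preserving the spin sectors `(N↑, N↓)` conserves the total particle number.
[folklore] -/
theorem card_eq_of_preservesSectors {H : Matrix (Finset (Orb Λ)) (Finset (Orb Λ)) ℂ}
    (hH : PreservesSectors H) (s s' : Finset (Orb Λ)) (h : H s s' ≠ 0) : s.card = s'.card := by
  obtain ⟨hu, hd⟩ := hH s s' h
  rw [card_eq_upPart_add_downPart s, card_eq_upPart_add_downPart s', hu, hd]

omit [LinearOrder Λ] in
/-- **The `N`-particle partition function as a diagonal sum**: for a number-conserving `H`,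
`partitionFn β (H|_{#s=N}) = Σ_{#s = N} (e^{-βH})_{ss}` (the exponential of the compression is the
compression of the exponential). [folklore] -/
theorem partitionFn_toBlock_card_eq_sum_gibbsWeight {instDE : DecidableEq (Finset (Orb Λ))}
    {H : Matrix (Finset (Orb Λ)) (Finset (Orb Λ)) ℂ}
    (hH : ∀ s s', H s s' ≠ 0 → s.card = s'.card) (β : ℝ) (N : ℕ) :
    partitionFn β (H.toBlock (fun s => s.card = N) (fun s => s.card = N)) =
      ∑ s ∈ Finset.univ.filter (fun s : Finset (Orb Λ) => s.card = N), gibbsWeight β H s s := by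
  rw [Matrix.partitionFn, ← toBlock_gibbsWeight_of_toBlock_compl_eq_zero β H _ (toBlock_card_compl_eq_zero hH N),
    ← trace_indicator_mul_eq_trace_toBlock (inst := instDE), trace_diagonal_mul_eq_sum, Finset.sum_filter]
  refine Finset.sum_congr rfl fun s _ => ?_
  split_ifs <;> simp

/-- The fugacity weight `diag(e^{ζ #s})` is the exponential `e^{ζ N}` of the number operator.
[folklore] -/
theorem diagonal_cexp_card_eq_exp_smul_totalNumber {instDE : DecidableEq (Finset (Orb Λ))} (ζ : ℂ) :
    (diagonal fun s : Finset (Orb Λ) => cexp (ζ * s.card)) =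
      NormedSpace.exp (ζ • (totalNumber : Matrix (Finset (Orb Λ)) (Finset (Orb Λ)) ℂ)) := by
  have h : ζ • (totalNumber : Matrix (Finset (Orb Λ)) (Finset (Orb Λ)) ℂ) =
      diagonal fun s : Finset (Orb Λ) => ζ * (s.card : ℂ) := by
    ext a b
    have ht := congrFun (congrFun (totalNumber_eq_diagonal_card (Λ := Λ)) a) b
    rw [Matrix.smul_apply, ht, smul_eq_mul]
    -- unfold `diagonal` by name: the two sides carry different decidable-equality instances
    simp only [Matrix.diagonal, Matrix.of_apply]
    by_cases hab : a = b
    · rw [if_pos hab, if_pos hab]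
    · rw [if_neg hab, if_neg hab, mul_zero]
  rw [h, Matrix.exp_diagonal]
  congr 1
  funext s
  rw [Pi.exp_def, ← Complex.exp_eq_exp_ℂ]

/-- **Fugacity-weighted trace = trace of one exponential** for an `H` commuting with `N`:
`Tr(diag(e^{ζ#s}) e^{-βH}) = Tr e^{ζN - βH}`. [folklore] -/
theorem trace_fugacity_mul_gibbsWeight_eq {instDE : DecidableEq (Finset (Orb Λ))}
    {H : Matrix (Finset (Orb Λ)) (Finset (Orb Λ)) ℂ}
    (hH : Commute H totalNumber) (β : ℝ) (ζ : ℂ) :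
    ((diagonal fun s : Finset (Orb Λ) => cexp (ζ * s.card)) * gibbsWeight β H).trace =
      (NormedSpace.exp (ζ • (totalNumber : Matrix (Finset (Orb Λ)) (Finset (Orb Λ)) ℂ) +
        -(β : ℂ) • H)).trace := by
  rw [diagonal_cexp_card_eq_exp_smul_totalNumber, Matrix.gibbsWeight, ← Matrix.exp_add_of_commute]
  exact (hH.symm.smul_left ζ).smul_right _

end Number

/-! ### The twisted `t–t'` torus -/

section Torus

variable {L : ℕ} [NeZero L]

/-- **The exponent at complex fugacity.** `ζN - βH^{tt'}_L(θ) = -βV_Λ(U, ζ/β) + Σ_b c_b T_b` with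
`c = ttFluxCoupling L β t' θ` (`L ≥ 3`, `β ≠ 0`): the complex chemical potential `ζ/β` enters only
the on-site operator. [programme: bounds.tex §13 step 0] -/
theorem smul_totalNumber_sub_smul_hubbardTorusTT'Flux_eq (hL : 3 ≤ L) {β : ℝ} (hβ : β ≠ 0)
    (t' U θ : ℝ) (ζ : ℂ) :
    ζ • (totalNumber : Matrix _ _ ℂ) + -(β : ℂ) • hubbardTorusTT'Flux L t' U θ =
      -((β : ℂ) • onSiteSum (U : ℂ) (ζ / β) (Finset.univ : Finset (FermionTorus 2 L))) +
        hopSum (ttFluxCoupling L β t' θ) := by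
  have h0 := neg_smul_hubbardTorusTT'FluxMu_eq hL β t' U 0 θ
  simp only [Complex.ofReal_zero, zero_smul, sub_zero] at h0
  have hβ' : (β : ℂ) ≠ 0 := by exact_mod_cast hβ
  have hmul : (β : ℂ) * (ζ / β) = ζ := mul_div_cancel₀ _ hβ'
  rw [h0, onSiteSum_univ_eq_smul_sub, onSiteSum_univ_eq_smul_sub, zero_smul, sub_zero, smul_sub,
    smul_smul, smul_smul, hmul]
  abel

/-- **Dictionary at complex fugacity.** `Tr(diag(e^{ζ #s}) e^{-βH^{tt'}_L(t',U;θ)}) =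
Zc(β, U, ζ/β; ttFluxCoupling L β t' θ)` (`L ≥ 3`, `β ≠ 0`): the fugacity-weighted trace of the twisted
torus is the tree's generalised Gibbs factor at the complex chemical potential `ζ/β`.
[programme: bounds.tex §13 step 0] -/
theorem trace_fugacity_mul_gibbsWeight_hubbardTorusTT'Flux_eq_Zc (hL : 3 ≤ L) {β : ℝ} (hβ : β ≠ 0)
    (t' U θ : ℝ) (ζ : ℂ) :
    ((diagonal fun s : Finset (Orb (FermionTorus 2 L)) => cexp (ζ * s.card)) *
        gibbsWeight β (hubbardTorusTT'Flux L t' U θ)).trace =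
      Zc (β : ℂ) (U : ℂ) (ζ / β) (ttFluxCoupling L β t' θ) := by
  rw [trace_fugacity_mul_gibbsWeight_eq (hubbardTorusTT'Flux_commute_totalNumber L t' U θ),
    smul_totalNumber_sub_smul_hubbardTorusTT'Flux_eq hL hβ, Zc]
  -- the two sides differ only in the (subsingleton) decidable-equality instance of the index type
  congr!

/-- **THEOREM (the canonical sector as a Fourier coefficient at complex fugacity; bounds.tex
(13.1)).** For `L ≥ 3`, `β ≠ 0`, any `M` larger than the number of orbitals, any `N < M` and any base
point `ζ₀ ∈ ℂ`:
`partitionFn β (H^{tt'}_L(θ)|_{#s=N}) = M⁻¹ Σ_{k<M} e^{-Nζ_k} Zc(β, U, ζ_k/β; ttFluxCoupling L β t' θ)`,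
`ζ_k = ζ₀ + 2πik/M`. [programme: bounds.tex §13 (13.1); this file] -/
theorem partitionFn_toBlock_card_hubbardTorusTT'Flux_eq_fourier (hL : 3 ≤ L) {β : ℝ} (hβ : β ≠ 0)
    (t' U θ : ℝ) {M N : ℕ} (hM : Fintype.card (Orb (FermionTorus 2 L)) < M) (hN : N < M) (ζ₀ : ℂ) :
    partitionFn β ((hubbardTorusTT'Flux L t' U θ).toBlock
        (fun s => s.card = N) (fun s => s.card = N)) =
      (M : ℂ)⁻¹ * ∑ k ∈ Finset.range M, cexp (-(N * fourierPoint M ζ₀ k)) *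
        Zc (β : ℂ) (U : ℂ) (fourierPoint M ζ₀ k / β) (ttFluxCoupling L β t' θ) := by
  rw [partitionFn_toBlock_card_eq_sum_gibbsWeight
      (card_eq_of_preservesSectors (preservesSectors_hubbardTorusTT'Flux L t' U θ)) β N,
    sum_filter_diag_eq_fourier (fun s : Finset (Orb (FermionTorus 2 L)) => s.card)
      (gibbsWeight β (hubbardTorusTT'Flux L t' U θ))
      (fun s => lt_of_le_of_lt (Finset.card_le_univ s) hM) hN ζ₀]
  refine congrArg _ (Finset.sum_congr rfl fun k _ => ?_)
  rw [trace_fugacity_mul_gibbsWeight_hubbardTorusTT'Flux_eq_Zc hL hβ]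

end Torus

end Summit.HubbardSuperconductivity.HubbardLadder.Bounds
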